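import Mathlib
import Literature.Topology.FourManifolds.MMSWRasmussen
import Literature.Topology.FourManifolds.MMSWRasmussenFacts
import Literature.Topology.FourManifolds.KirbyMoves
import Literature.Topology.FourManifolds.HomotopyBallSlice
import Literature.Barriers.SmoothPoincare4.GluckTwistsDissolve
import Summits.SmoothPoincare4.SmoothPoincare4.Theses.DottedCircleRasmussen

/-!
# Sketch — crux-ideate `stmt-SmoothPoincare4-16151` (`DcrRasmussenWitness`), ideator 1, round 1

First-lemma sketches for the three crux idea cards (they must ELABORATE; proofs are not required,
but the pure-logic ones are given):

* §1 `dotted-zero-surgery-friends` — the 3-dimensional vocabulary of the transfer C⁺ (surgery on the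
  model `M_k = ∂D_k` along a model knot, via Kirby's "dots → zeros" Lemma 2.1, over the tree's
  `IsIntegralSurgeryLink` data with the surgery solid tori EXPOSED so that dual knots can be named),
  the DOTTED MANOLESCU–PICCIRILLO LEMMA as a named-fact-shaped `Prop`, the group-theoretic form of
  its new hypothesis (★), and the logic `C⁺ ∧ certificate → crux`.
* §2 `annulus-threshold` — the knot-level shadow that is typeable today: the sandwich
  `s₋(K) ≤ s(D(j⃗))` for every drawing (MMSW Prop. 8.2 / stab(3) + Thm 2.8) and the pre-filter it gives.
* §3 `fgmw-local-import` — `FGMWRasmussenStrategy → (local model knots) → DcrRasmussenWitness`.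
-/

open scoped Manifold ContDiff Topology
open Function Set

noncomputable section

namespace Summit.SmoothPoincare4.SmoothPoincare4.Cruxes.DcrRasmussenWitness.Sketch

open Literature.Topology.FourManifolds
open Literature.Topology.FourManifolds.MMSW
open Literature.AlgebraicTopology.Homotopy.HopfFibration (wC)

local notation "𝔼 " n:arg => EuclideanSpace ℝ (Fin n)
local notation "𝕊 " n:arg => (Metric.sphere (0 : EuclideanSpace ℝ (Fin (n + 1))) 1)

/-! ## §1  Dotted zero-surgery friends (card `dotted-zero-surgery-friends`) -/

/-- The `j`-th DOTTED CIRCLE of the standard picture of `M_k`: the horizontal circle of radius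
`c_j + C_k` at height `0` in `ℝ³`, placed in `𝕊³` by the inverse stereographic map of
`MMSWRasmussen` (`toSphereThree`).  Kirby's Lemma 2.1: `0`-surgery on these `k` circles is `M_k`,
and a model knot `K ⊂ ∂D_k` missing the cores is the knot `finiteApprox k 0 K` in their complement. -/
def dottedCircle (k : ℕ) (j : Fin k) (t : 𝕊 1) : 𝕊 3 :=
  toSphereThree
    (((4 * (((j : ℕ) : ℝ) + 1) + drawRadius k) * (t : 𝔼 2) 0),
     ((4 * (((j : ℕ) : ℝ) + 1) + drawRadius k) * (t : 𝔼 2) 1)) 0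

/-- Integral surgery on a framed link in `S³` WITH THE SURGERY SOLID TORI EXPOSED: word for word the
body of the tree's `IsIntegralSurgeryLink (𝓡 3) Y L m`, except that the embeddings
`jB i : D̊² × 𝕊¹ → Y` of the glued-in solid tori are arguments, so that the DUAL KNOT of the `i`-th
component — the core `jB i (0, ·)` — is a named curve in `Y`. -/
def IsSurgeryWithTori {ι : Type*} [Finite ι] (L : Link ι) (m : ι → ℤ) (Y : Type*)
    [TopologicalSpace Y] [ChartedSpace (𝔼 3) Y] (jB : ι → solidTorus → Y) : Prop :=
  ∃ ν : ∀ i, Knot.TubularNbhd (L.component i), (∀ i, (ν i).HasFraming (m i)) ∧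
    (Pairwise fun i j ↦ Disjoint (range (ν i)) (range (ν j))) ∧
    ∃ (jA : L.complement → Y),
      Manifold.IsSmoothEmbedding (𝓡 3) (𝓡 3) ∞ jA ∧ IsOpen (range jA) ∧
      (∀ i, Manifold.IsSmoothEmbedding (𝓘(ℝ, 𝔼 2).prod (𝓡 1)) (𝓡 3) ∞ (jB i) ∧
        IsOpen (range (jB i))) ∧
      range jA ∪ (⋃ i, range (jB i)) = univ ∧
      (Pairwise fun i j ↦ Disjoint (range (jB i)) (range (jB j))) ∧
      ∀ i a b, jA a = jB i b ↔ Link.surgeryRel ν i a b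

/-- Sanity: forgetting the tori gives back the tree's surgery predicate. -/
theorem isIntegralSurgeryLink_of_isSurgeryWithTori {ι : Type*} [Finite ι] {L : Link ι} {m : ι → ℤ}
    {Y : Type*} [TopologicalSpace Y] [ChartedSpace (𝔼 3) Y] {jB : ι → solidTorus → Y}
    (h : IsSurgeryWithTori L m Y jB) : IsIntegralSurgeryLink (𝓡 3) Y L m := by
  obtain ⟨ν, hν, hd, jA, h1, h2, h3, h4, h5, h6⟩ := h
  exact ⟨ν, hν, hd, jA, jB, h1, h2, h3, h4, h5, h6⟩

/-- The core circle (dual knot) of the `i`-th surgery solid torus. -/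
def dualKnot {ι : Type*} {Y : Type*} (jB : ι → solidTorus → Y) (i : ι) (v : 𝕊 1) : Y :=
  jB i ⟨((0 : 𝔼 2), v), by simp⟩

/-- **`Y` is `fr`-surgery on `M_k` along the model knot `K`, with dual knot `γ`** (dots → zeros,
Kirby 1989 Ch. I Lemma 2.1): there is a framed link in `S³` indexed by `Fin (k+1)` whose first `k`
components are the dotted circles with framing `0` and whose last component is the standard picture
`finiteApprox k 0 K` of `K` with framing `fr`, surgery on which is `Y`, the last surgery torus having
core `γ`.  (`K` should miss the cores `{w = 0}`; for a null-homologous `K` the framing `fr = 0` read in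
`S³` is the Seifert framing in `M_k`, since `lk(K, O_j) = 0`.) -/
def IsDottedSurgery (k : ℕ) (K : 𝕊 1 → 𝔼 4) (fr : ℤ) (Y : Type*) [TopologicalSpace Y]
    [ChartedSpace (𝔼 3) Y] (γ : 𝕊 1 → Y) : Prop :=
  ∃ (L : Link (Fin (k + 1))) (jB : Fin (k + 1) → solidTorus → Y),
    (∀ j : Fin k, ⇑(L.component (Fin.castSucc j)) = dottedCircle k j) ∧
    ⇑(L.component (Fin.last k)) = finiteApprox k 0 K ∧
    IsSurgeryWithTori L (fun i ↦ if i = Fin.last k then fr else 0) Y jB ∧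
    dualKnot jB (Fin.last k) = γ

/-- The crux's four-dimensional clause, isolated: `K ⊂ ∂D_k` bounds a smooth proper disc in the
complement of (an embedded copy of) the dotted handlebody `D_k` in SOME homotopy 4-sphere. -/
def ComplementSliceInHomotopySphere (k : ℕ) (K : 𝕊 1 → 𝔼 4) : Prop :=
  ∃ (M : Type) (_ : TopologicalSpace M) (_ : T2Space M) (_ : SecondCountableTopology M)
    (_ : ChartedSpace (𝔼 4) M) (_ : IsManifold (𝓡 4) ((⊤ : ℕ∞) : WithTop ℕ∞) M),
    Nonempty (ContinuousMap.HomotopyEquiv M (𝕊 4)) ∧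
      ∃ (e : 𝔼 4 → M) (f : 𝔼 2 → M), IsSliceDiscInComplement k K M e f

/-- **THE DOTTED MANOLESCU–PICCIRILLO LEMMA** (named-fact shape; the First lemma of the line).
Let `K₀, K₁ ⊂ M_k = ∂D_k` be null-homologous model knots with a COMMON Seifert-framed surgery `Y`
(dotted `0`-surgery friends), such that
* `K₁` bounds a smooth proper disc in `ℝ⁴ ∖ D_k°` (`IsModelSliceDisc` — e.g. any band-sum of
  antiparallel push-offs of the cores; no sliceness search), and
* (★) the two DUAL KNOTS are freely homotopic in `Y` up to orientation
  (this is what is automatic at `k = 0` and is NOT at `k ≥ 1`: it makes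
  `π₁(Z₀(K₀) ∪_Y (S⁴ ∖ Z₀(K₁)°)) = π₁(C)/⟨⟨dual₀⟩⟩` trivial, `C = S⁴ ∖ Z₀(K₁)°` being normally
  generated by `dual₁`).
Then `K₀` bounds a smooth proper disc in the complement of `D_k` in the homotopy 4-sphere
`Σ = Z₀(K₀) ∪_Y (S⁴ ∖ Z₀(K₁)°)` (`Z₀ = D_k ∪ 2-handle`: the disc is the core of the 2-handle;
`χ(Σ) = 2`, `π₁ = 1` by (★), hence `Σ ≃ S⁴`; `D_k ⊂ Σ` extends to an embedded `ℝ⁴` because a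
1-complex unknots in a simply connected 4-manifold).  Classical topology throughout
(cf. the tree's PROVED `Knot.ManolescuPiccirillo2023_lemma33_sphere_holds`, the case `k = 0`). -/
def DottedMPLemma : Prop :=
  ∀ (k : ℕ) (K₀ K₁ : 𝕊 1 → 𝔼 4) (Y : Type) [TopologicalSpace Y] [T2Space Y]
    [SecondCountableTopology Y] [ChartedSpace (𝔼 3) Y] [IsManifold (𝓡 3) ((⊤ : ℕ∞) : WithTop ℕ∞) Y]
    (γ₀ γ₁ : 𝕊 1 → Y),
    IsModelKnot k K₀ → IsNullHomologous k K₀ → (∀ t, wC (K₀ t) ≠ 0) →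
    IsModelKnot k K₁ → IsNullHomologous k K₁ → (∀ t, wC (K₁ t) ≠ 0) →
    (∃ f : 𝔼 2 → 𝔼 4, IsModelSliceDisc k K₁ f) →
    IsDottedSurgery k K₀ 0 Y γ₀ → IsDottedSurgery k K₁ 0 Y γ₁ →
    (∃ (h₀ : Continuous γ₀) (h₁ : Continuous γ₁),
        (ContinuousMap.mk γ₀ h₀).Homotopic (ContinuousMap.mk γ₁ h₁) ∨
        (ContinuousMap.mk γ₀ h₀).Homotopic
          (ContinuousMap.mk (γ₁ ∘ fun v : 𝕊 1 ↦ ⟨-(v : 𝔼 2), by simpa using v.2⟩)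
            (h₁.comp (by fun_prop)))) →
    ComplementSliceInHomotopySphere k K₀

/-- The transferred crux **C⁺ (friends form)**: dotted `0`-surgery friends `(K₀, K₁)` in some
`M_k`, `k ≥ 1`, with `K₁` handlebody-slice, (★), and a Rasmussen certificate ON `K₀` ALONE. -/
def CruxPlus : Prop :=
  ∃ k : ℕ, 1 ≤ k ∧ ∃ (K₀ K₁ : 𝕊 1 → 𝔼 4) (Y : Type) (_ : TopologicalSpace Y) (_ : T2Space Y)
    (_ : SecondCountableTopology Y) (_ : ChartedSpace (𝔼 3) Y)
    (_ : IsManifold (𝓡 3) ((⊤ : ℕ∞) : WithTop ℕ∞) Y) (γ₀ γ₁ : 𝕊 1 → Y),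
    IsModelKnot k K₀ ∧ IsNullHomologous k K₀ ∧ (∀ t, wC (K₀ t) ≠ 0) ∧
    IsModelKnot k K₁ ∧ IsNullHomologous k K₁ ∧ (∀ t, wC (K₁ t) ≠ 0) ∧
    (∃ f : 𝔼 2 → 𝔼 4, IsModelSliceDisc k K₁ f) ∧
    IsDottedSurgery k K₀ 0 Y γ₀ ∧ IsDottedSurgery k K₁ 0 Y γ₁ ∧
    (∃ (h₀ : Continuous γ₀) (h₁ : Continuous γ₁),
        (ContinuousMap.mk γ₀ h₀).Homotopic (ContinuousMap.mk γ₁ h₁) ∨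
        (ContinuousMap.mk γ₀ h₀).Homotopic
          (ContinuousMap.mk (γ₁ ∘ fun v : 𝕊 1 ↦ ⟨-(v : 𝔼 2), by simpa using v.2⟩)
            (h₁.comp (by fun_prop)))) ∧
    ∃ w : MMSWRasmussen k K₀, 0 < w.sMinus ∨ w.sPlus < 0

/-- **C⁺ → crux**, modulo the dotted MP lemma: pure logic. -/
theorem dcrRasmussenWitness_of_cruxPlus (hMP : DottedMPLemma) (h : CruxPlus) :
    Summit.SmoothPoincare4.SmoothPoincare4.Theses.DottedCircleRasmussen.DcrRasmussenWitness := by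
  obtain ⟨k, hk, K₀, K₁, Y, _, _, _, _, _, γ₀, γ₁, hK₀, h0₀, hw₀, hK₁, h0₁, hw₁, hsl, hs₀, hs₁,
    hstar, w, hw⟩ := h
  obtain ⟨M, i1, i2, i3, i4, i5, hM, e, f, hef⟩ :=
    hMP k K₀ K₁ Y γ₀ γ₁ hK₀ h0₀ hw₀ hK₁ h0₁ hw₁ hsl hs₀ hs₁ hstar
  exact ⟨k, hk, K₀, hK₀, h0₀, ⟨M, i1, i2, i3, i4, i5, hM, e, f, hef⟩, w, hw⟩

/-- The algebra behind (★) (van Kampen for `Σ = Z₀(K₀) ∪_Y C`): if `π₁(Σ) = π₁(C)/⟨⟨c₀⟩⟩` where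
`c₀` is the image of the dual knot of `K₀`, and `π₁(C)` is the normal closure of the dual knot `c₁` of
`K₁` (because `C ∪ (2-handle along c₁) ∪ 3,4-handles = S⁴`), then `Σ` is simply connected as soon
as `c₀` is conjugate to `c₁^{±1}` — in fact iff the normal closure of `c₀` is everything. -/
theorem normalClosure_eq_top_of_conj {G : Type*} [Group G] {c₀ c₁ : G}
    (h₁ : Subgroup.normalClosure ({c₁} : Set G) = ⊤)
    (hc : ∃ g : G, c₀ = g * c₁ * g⁻¹ ∨ c₀ = g * c₁⁻¹ * g⁻¹) :
    Subgroup.normalClosure ({c₀} : Set G) = ⊤ := by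
  obtain ⟨g, hg⟩ := hc
  rw [eq_top_iff, ← h₁]
  refine Subgroup.normalClosure_le_normal ?_
  intro x hx
  rw [Set.mem_singleton_iff] at hx
  subst hx
  have hc₀ : c₀ ∈ Subgroup.normalClosure ({c₀} : Set G) :=
    Subgroup.subset_normalClosure (Set.mem_singleton _)
  have hN := (Subgroup.normalClosure_normal (s := ({c₀} : Set G)))
  rcases hg with h | h
  · -- x = g⁻¹ * c₀ * g
    have : x = g⁻¹ * c₀ * g⁻¹⁻¹ := by rw [h]; group
    rw [this]
    exact hN.conj_mem _ hc₀ g⁻¹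
  · have : x = (g⁻¹ * c₀ * g⁻¹⁻¹)⁻¹ := by rw [h]; group
    rw [this]
    exact Subgroup.inv_mem _ (hN.conj_mem _ hc₀ g⁻¹)

/-! ## §2  Annulus threshold (card `annulus-threshold`) — the typeable knot-level shadow -/

/-- **Sandwich, lower half** (MMSW Prop. 8.2 (i) / stabilisation item (3) with Thm 2.8; named-fact
shape): `s₋(K)` is a lower bound for the ordinary Rasmussen invariant of EVERY finite approximation
`D(j⃗)`, `j ∈ ℤ` — not only the large ones — because `D(j⃗)(K) = D(0⃗)(σʲK)`, `s₋(σʲK) = s₋(K)`, and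
adding full twists on balanced strands only decreases `s` (generalised negative crossings,
Thm 1.11).  [ManolescuMarengonSarkarWillis2023, Prop. 8.2, §8.2 item (3), Thm 1.11] -/
def sMinus_le_approx : Prop :=
  ∀ {k : ℕ} {K : 𝕊 1 → 𝔼 4} {s s' : ℤ} {j : ℤ}, HasSMinus k K s → (∀ t, wC (K t) ≠ 0) →
    ApproxHasRasmussen k j K s' → s ≤ s'

/-- **Mirror half**: `s₊(K)` is an upper bound for every `s(D(j⃗))`. -/
def approx_le_sPlus : Prop :=
  ∀ {k : ℕ} {K : 𝕊 1 → 𝔼 4} {s s' : ℤ} {j : ℤ}, HasSPlus k K s → (∀ t, wC (K t) ≠ 0) →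
    ApproxHasRasmussen k j K s' → s' ≤ s

/-- **Pre-filter** (the knot-level floor): a certificate knot has ALL its drawings `D(j⃗)` — in
particular the dots-erased knot `D(0⃗)` — of Rasmussen invariant `> 0` (resp. `< 0`); one drawing
with `s = 0` (unknotted / slice / amphicheiral with the dots erased) kills both branches. -/
theorem prefilter (hlo : sMinus_le_approx) (hhi : approx_le_sPlus) {k : ℕ} {K : 𝕊 1 → 𝔼 4}
    (hw : ∀ t, wC (K t) ≠ 0) (w : MMSWRasmussen k K) (hc : 0 < w.sMinus ∨ w.sPlus < 0)
    {j : ℤ} {s' : ℤ} (hj : ApproxHasRasmussen k j K s') : s' ≠ 0 := by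
  rcases hc with h | h
  · have := hlo w.hasSMinus hw hj; omega
  · have := hhi w.hasSPlus hw hj; omega

/-! ## §3  FGMW local import (card `fgmw-local-import`) -/

/-- **Local model knots carry the ordinary `s`** (MMSW Example 8.3 / 8.33; the one new fact the
import needs, named-fact shape): every knot `K ⊂ S³` that is slice in a homotopy ball and has
`s(K) = s` is realised, inside a small ball of `∂D_1` (one dotted circle, away from it), by a
null-homologous model knot `K₀` that is complement-slice in a homotopy 4-sphere (the same `Σ`:
`Σ° ♮ (S² × D²) ⊃ Σ°`) with MMSW invariants `s₋(K₀) = s₊(K₀) = s`. -/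
def LocalModelImport : Prop :=
  ∀ (K : Knot) (s : ℤ), K.IsHomotopyBallSlice → K.HasRasmussenInvariant s →
    ∃ K₀ : 𝕊 1 → 𝔼 4, IsModelKnot 1 K₀ ∧ IsNullHomologous 1 K₀ ∧
      ComplementSliceInHomotopySphere 1 K₀ ∧
      ∃ w : MMSWRasmussen 1 K₀, w.sMinus = s ∧ w.sPlus = s

/-- **`k = 0 ⇒ k = 1`**: a success of the Freedman–Gompf–Morrison–Walker strategy (registered open
statement `Literature.Barriers.SmoothPoincare4.FGMWRasmussenStrategy`, implied by the sibling crux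
`ZseCruxRasmussen`) is a dotted certificate with one dotted circle. Pure logic over the import. -/
theorem dcrRasmussenWitness_of_fgmw (hloc : LocalModelImport)
    (h : Literature.Barriers.SmoothPoincare4.FGMWRasmussenStrategy) :
    Summit.SmoothPoincare4.SmoothPoincare4.Theses.DottedCircleRasmussen.DcrRasmussenWitness := by
  obtain ⟨K, hK, s, hs, hs0⟩ := h
  obtain ⟨K₀, hK₀, h0, ⟨M, i1, i2, i3, i4, i5, hM, e, f, hef⟩, w, hm, hp⟩ := hloc K s hK hs
  refine ⟨1, le_rfl, K₀, hK₀, h0, ⟨M, i1, i2, i3, i4, i5, hM, e, f, hef⟩, w, ?_⟩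
  rcases lt_or_gt_of_ne hs0 with h | h
  · right; omega
  · left; omega

end Summit.SmoothPoincare4.SmoothPoincare4.Cruxes.DcrRasmussenWitness.Sketch

end
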